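import Mathlib.CategoryTheory.Limits.Shapes.BinaryBiproducts
import Mathlib.CategoryTheory.Preadditive.Biproducts
import Literature.AlgebraicGeometry.Motives.AbelianVariety
import HarnessLib

/-!
# Products of abelian varieties

For abelian varieties `A, B` over a field `k` the fibre product `A ×ₖ B`, with the product group
law, is an abelian variety over `k`, and together with its two projections it is a product — hence,
the category being preadditive, a biproduct — of `A` and `B` in the category `Literature.AbelianVariety k`
of abelian varieties over `k` with homomorphisms (Milne, *Abelian Varieties* (1986), Conventions,
p. 103: "a product of varieties is a variety", and §1, p. 104: an abelian variety is a complete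
group variety; Mumford, *Abelian Varieties*, §4 and §19 (products, `Hom(A × B, C)`); Kieffer 2024,
§1.1.1, p. 8: "if `A` and `B` are abelian varieties of any dimension, then `A × B` is an abelian
variety as well"). Everything in this file is proved.

## Main definitions and results

* `Literature.AlgebraicGeometry.Motives.geometricallyIntegral_comp`: if `f : X → Y` is geometrically integral, flat and universally
  open and `g : Y → Z` is geometrically integral and locally of finite type, then `f ≫ g` is
  geometrically integral (for a field-valued point `y` of `Z`,
  `X ×_Z y = X ×_Y (Y ×_Z y)` is the total space of a geometrically integral flat open morphism
  onto the integral locally noetherian scheme `Y ×_Z y`, Mathlib's instance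
  `IsIntegral (pullback f g)` of `Mathlib.AlgebraicGeometry.Geometrically.Integral`);
* `Literature.AbelianVariety.prod A B`: the abelian variety `A ×ₖ B` — the group object `A.X ⊗ B.X` of
  the cartesian monoidal category `Over (Spec k)` (Mathlib `GrpObj.tensorObj.instTensorObj`),
  proper (base change and composition) and geometrically integral (`geometricallyIntegral_comp`,
  everything being flat and universally open over a field) over `k`;
* `Literature.AlgebraicGeometry.Motives.AbelianVariety.fst`, `snd`, `prodLift`: the projections and the pairing of homomorphisms,
  Mathlib's cartesian monoidal structure of `Grp (Over (Spec k))`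
  (`Grp.instCartesianMonoidalCategory`: the pairing of two homomorphisms is a homomorphism);
* `Literature.AlgebraicGeometry.Motives.AbelianVariety.prodBinaryFanIsLimit`: `(A ×ₖ B, fst, snd)` is a product of `A` and `B` in
  `AbelianVariety k`; instances `HasBinaryProducts (AbelianVariety k)` and
  `HasBinaryBiproducts (AbelianVariety k)` (Mathlib `HasBinaryBiproducts.of_hasBinaryProducts`
  for the preadditive structure of `Motives/AbelianVariety`), and
  `Literature.AbelianVariety.hasBinaryBiproduct_inst A B : HasBinaryBiproduct A B` — the statement of
  the named fact `Literature.AlgebraicGeometry.Motives.AbelianVariety.hasBinaryBiproduct` of `Motives/TateAbelianFiniteSteps`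
  (discharged there, this file being upstream of it);
* `Literature.AlgebraicGeometry.Motives.AbelianVariety.biprodIsoProd`: `A ⊞ B ≅ A ×ₖ B` compatibly with the projections.

Mathlib has no bundled abelian varieties (searched `AbelianVariety`: only
`Mathlib/AlgebraicGeometry/Group/Abelian.lean`, commutativity), hence no products of them; all the
scheme- and group-object-level ingredients are Mathlib's, as listed.

## References

* J. S. Milne, *Abelian Varieties*, Ch. V of Cornell–Silverman, *Arithmetic Geometry* (1986),
  Conventions (p. 103) and §1 (p. 104). [Milne1986AbelianVarieties]
* D. Mumford, *Abelian Varieties* (1970), §4 (definition), §19 (homomorphisms). [MumfordAV1970]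
* J. Kieffer, *Isogeny graphs of abelian varieties over finite fields* (2024), §1.1.1 p. 8,
  §1.2.2 p. 22. [Kieffer2024IsogenyGraphs]
* The Stacks project, Tag 0BF9 (abelian varieties).
-/

universe u

open CategoryTheory CategoryTheory.Limits AlgebraicGeometry MonoidalCategory

noncomputable section

namespace Literature.AlgebraicGeometry.Motives

/-! ## Geometric integrality of a composition -/

/-- **Composites of geometrically integral morphisms.** Let `f : X → Y` be geometrically integral,
flat and universally open, and `g : Y → Z` geometrically integral and locally of finite type. Then
`f ≫ g : X → Z` is geometrically integral: for a point `y : Spec K → Z` with `K` a field,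
`X ×_Z Spec K ≅ X ×_Y (Y ×_Z Spec K)` (pasting of pullbacks), where `Y ×_Z Spec K` is integral
(geometric integrality of `g`) and locally noetherian (locally of finite type over `K`), and
`X ×_Y (Y ×_Z Spec K) → Y ×_Z Spec K` is a base change of `f`, so its total space is integral by
Mathlib's `IsIntegral (pullback f g)` (a geometrically integral, flat, universally open morphism to
an integral locally noetherian scheme has integral total space). This is the scheme-theoretic
content of "a product of varieties is a variety" (Milne 1986, Conventions, p. 103).
[cite: Milne1986AbelianVarieties, Conventions p. 103] -/
theorem geometricallyIntegral_comp {X Y Z : Scheme.{u}} (f : X ⟶ Y) (g : Y ⟶ Z)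
    [GeometricallyIntegral f] [Flat f] [UniversallyOpen f]
    [GeometricallyIntegral g] [LocallyOfFiniteType g] :
    GeometricallyIntegral (f ≫ g) := by
  refine ⟨fun K _ y W p q h ↦ ?_⟩
  haveI : IsIntegral (pullback g y) :=
    GeometricallyIntegral.geometrically_isIntegral (f := g) y _ _ (IsPullback.of_hasPullback g y)
  haveI : IsIntegral (pullback f (pullback.fst g y)) := inferInstance
  exact IsIntegral.of_isIso ((pullbackRightPullbackFstIso g y f).hom ≫ h.isoPullback.inv)

namespace AbelianVariety

variable {k : Type u} [Field k] (A B : AbelianVariety k)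

/-! ## The product abelian variety -/

/-- **The product `A ×ₖ B` of two abelian varieties over `k` is an abelian variety over `k`**
(Milne 1986, Conventions p. 103 and §1 p. 104; Mumford §4; Kieffer 2024, §1.1.1 p. 8). The
underlying `k`-group scheme is the product group object `A.X ⊗ B.X` of the cartesian monoidal
category `Over (Spec k)` (Mathlib `GrpObj.tensorObj.instTensorObj`: componentwise group law); the
structure morphism `A ×ₖ B → A → Spec k` is proper (Mathlib: properness is stable under base
change and composition) and geometrically integral (`geometricallyIntegral_comp`; the projection
`A ×ₖ B → A` is a base change of `B → Spec k`, hence geometrically integral, and flat and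
universally open like every morphism to the spectrum of a field).
[cite: Milne1986AbelianVarieties, Conventions p. 103 and §1 p. 104] -/
def prod : AbelianVariety k where
  X := A.X ⊗ B.X
  isProper := by
    change IsProper (pullback.fst A.X.hom B.X.hom ≫ A.X.hom)
    infer_instance
  geometricallyIntegral := by
    change GeometricallyIntegral (pullback.fst A.X.hom B.X.hom ≫ A.X.hom)
    exact geometricallyIntegral_comp _ _

/-- The underlying `k`-group scheme of `A ×ₖ B` is `A.X ⊗ B.X` (by construction). [folklore] -/
@[simp]
theorem prod_X : (A.prod B).X = A.X ⊗ B.X := rfl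

/-- The underlying scheme of `A ×ₖ B` is the fibre product `A ×_{Spec k} B` (by construction;
Mathlib `Over.tensorObj_left`). [folklore] -/
theorem prod_X_left : (A.prod B).X.left = pullback A.X.hom B.X.hom := rfl

/-- The structure morphism of `A ×ₖ B` is `A ×_{Spec k} B → A → Spec k` (Mathlib
`Over.tensorObj_hom`). [folklore] -/
theorem prod_X_hom : (A.prod B).X.hom = pullback.fst A.X.hom B.X.hom ≫ A.X.hom := rfl

/-- As a group object, `A ×ₖ B` is the product `A.toGrp ⊗ B.toGrp` in Mathlib's cartesian
monoidal category `Grp (Over (Spec k))` (by construction; `rfl`). [folklore] -/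
theorem toGrp_prod : (A.prod B).toGrp = A.toGrp ⊗ B.toGrp := rfl

/-! ## Projections and pairing -/

/-- The first projection `A ×ₖ B → A`, a homomorphism (Mathlib `CartesianMonoidalCategory.fst`
in `Grp (Over (Spec k))`; Milne 1986, Conventions: "the two projection maps `p`, `q`").
[folklore] -/
def fst : A.prod B ⟶ A :=
  InducedCategory.homMk (CartesianMonoidalCategory.fst A.toGrp B.toGrp)

/-- The second projection `A ×ₖ B → B`, a homomorphism (Mathlib `CartesianMonoidalCategory.snd`
in `Grp (Over (Spec k))`). [folklore] -/
def snd : A.prod B ⟶ B :=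
  InducedCategory.homMk (CartesianMonoidalCategory.snd A.toGrp B.toGrp)

variable {A B} {T : AbelianVariety k}

/-- The pairing `(f, g) : T → A ×ₖ B` of two homomorphisms is a homomorphism (Mathlib
`CartesianMonoidalCategory.lift` in `Grp (Over (Spec k))`, i.e. `Grp.instCartesianMonoidalCategory`:
the pairing of monoid morphisms is a monoid morphism). [folklore] -/
def prodLift (f : T ⟶ A) (g : T ⟶ B) : T ⟶ A.prod B :=
  InducedCategory.homMk (X := T) (Y := A.prod B)
    (CartesianMonoidalCategory.lift f.hom g.hom : T.toGrp ⟶ A.toGrp ⊗ B.toGrp)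

/-- A homomorphism `T → A ×ₖ B` *is* a morphism `T.toGrp ⟶ A.toGrp ⊗ B.toGrp` of group objects
(`toGrp_prod`); this reducible cast lets Mathlib's cartesian-monoidal lemmas for `Grp` apply to
`f.hom` without unfolding `prod` during unification. [folklore] -/
abbrev Hom.toProdGrp (f : T ⟶ A.prod B) : T.toGrp ⟶ A.toGrp ⊗ B.toGrp := f.hom

/-- `Hom.toProdGrp f` is `f.hom` (`rfl`). [folklore] -/
theorem Hom.toProdGrp_eq (f : T ⟶ A.prod B) : Hom.toProdGrp f = f.hom := rfl

/-- `fst` is Mathlib's `CartesianMonoidalCategory.fst` of `Grp (Over (Spec k))` (`rfl`). [folklore] -/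
@[simp]
theorem fst_hom : (fst A B).hom = CartesianMonoidalCategory.fst A.toGrp B.toGrp := rfl

/-- `snd` is Mathlib's `CartesianMonoidalCategory.snd` of `Grp (Over (Spec k))` (`rfl`). [folklore] -/
@[simp]
theorem snd_hom : (snd A B).hom = CartesianMonoidalCategory.snd A.toGrp B.toGrp := rfl

/-- `prodLift f g` is Mathlib's `CartesianMonoidalCategory.lift f.hom g.hom` of
`Grp (Over (Spec k))` (`rfl`). [folklore] -/
@[simp]
theorem prodLift_hom (f : T ⟶ A) (g : T ⟶ B) :
    Hom.toProdGrp (prodLift f g) = CartesianMonoidalCategory.lift f.hom g.hom := rfl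

/-- `(f, g) ≫ fst = f`. [folklore] -/
@[reassoc (attr := simp)]
theorem prodLift_fst (f : T ⟶ A) (g : T ⟶ B) : prodLift f g ≫ fst A B = f :=
  InducedCategory.hom_ext
    (show Hom.toProdGrp (prodLift f g) ≫ CartesianMonoidalCategory.fst A.toGrp B.toGrp = f.hom from
      CartesianMonoidalCategory.lift_fst f.hom g.hom)

/-- `(f, g) ≫ snd = g`. [folklore] -/
@[reassoc (attr := simp)]
theorem prodLift_snd (f : T ⟶ A) (g : T ⟶ B) : prodLift f g ≫ snd A B = g :=
  InducedCategory.hom_ext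
    (show Hom.toProdGrp (prodLift f g) ≫ CartesianMonoidalCategory.snd A.toGrp B.toGrp = g.hom from
      CartesianMonoidalCategory.lift_snd f.hom g.hom)

/-- Two homomorphisms into `A ×ₖ B` agree if their two components do. [folklore] -/
theorem prod_hom_ext {f g : T ⟶ A.prod B} (h₁ : f ≫ fst A B = g ≫ fst A B)
    (h₂ : f ≫ snd A B = g ≫ snd A B) : f = g :=
  InducedCategory.hom_ext
    (show Hom.toProdGrp f = Hom.toProdGrp g from
      CartesianMonoidalCategory.hom_ext (Hom.toProdGrp f) (Hom.toProdGrp g)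
        (show Hom.toProdGrp f ≫ CartesianMonoidalCategory.fst A.toGrp B.toGrp =
            Hom.toProdGrp g ≫ CartesianMonoidalCategory.fst A.toGrp B.toGrp from
          congrArg InducedCategory.Hom.hom h₁)
        (show Hom.toProdGrp f ≫ CartesianMonoidalCategory.snd A.toGrp B.toGrp =
            Hom.toProdGrp g ≫ CartesianMonoidalCategory.snd A.toGrp B.toGrp from
          congrArg InducedCategory.Hom.hom h₂))

/-- On underlying schemes, `fst` is the first projection of the fibre product. [folklore] -/
@[simp]
theorem toSchemeHom_fst : Hom.toSchemeHom (fst A B) = pullback.fst A.X.hom B.X.hom := rfl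

/-- On underlying schemes, `snd` is the second projection of the fibre product. [folklore] -/
@[simp]
theorem toSchemeHom_snd : Hom.toSchemeHom (snd A B) = pullback.snd A.X.hom B.X.hom := rfl

/-- On underlying schemes, `(f, g)` is `pullback.lift` of the underlying morphisms. [folklore] -/
theorem toSchemeHom_prodLift (f : T ⟶ A) (g : T ⟶ B) :
    Hom.toSchemeHom (prodLift f g) =
      pullback.lift (Hom.toSchemeHom f) (Hom.toSchemeHom g)
        ((Over.w f.hom.hom.hom).trans (Over.w g.hom.hom.hom).symm) := rfl

/-! ## `A ×ₖ B` is a (bi)product in `AbelianVariety k` -/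

variable (A B)

/-- The cone `(A ×ₖ B, fst, snd)` over the pair `(A, B)`. [folklore] -/
def prodBinaryFan : BinaryFan A B :=
  BinaryFan.mk (fst A B) (snd A B)

/-- The first leg of the cone `prodBinaryFan A B` is `fst` (`rfl`). [folklore] -/
@[simp]
theorem prodBinaryFan_fst : (prodBinaryFan A B).fst = fst A B := rfl

/-- The second leg of the cone `prodBinaryFan A B` is `snd` (`rfl`). [folklore] -/
@[simp]
theorem prodBinaryFan_snd : (prodBinaryFan A B).snd = snd A B := rfl

/-- **`A ×ₖ B` with its projections is a product of `A` and `B` in the category of abelian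
varieties over `k` with homomorphisms** (Mumford §19: `Hom(C, A × B) = Hom(C, A) ⊕ Hom(C, B)`;
Kieffer 2024, §1.2.2 p. 22). The universal property is that of the product group object in
`Grp (Over (Spec k))` (Mathlib `Grp.instCartesianMonoidalCategory`), the category of abelian
varieties being a full subcategory. [cite: Kieffer2024IsogenyGraphs, §1.1.1 p. 8 and §1.2.2 p. 22] -/
def prodBinaryFanIsLimit : IsLimit (prodBinaryFan A B) :=
  BinaryFan.IsLimit.mk _ (fun f g ↦ prodLift f g) (fun f g ↦ prodLift_fst f g)
    (fun f g ↦ prodLift_snd f g)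
    (fun f g _ h₁ h₂ ↦
      prod_hom_ext (h₁.trans (prodLift_fst f g).symm) (h₂.trans (prodLift_snd f g).symm))

/-- Binary products exist in `AbelianVariety k`. [folklore] -/
instance hasBinaryProduct_inst : HasBinaryProduct A B :=
  HasLimit.mk ⟨_, prodBinaryFanIsLimit A B⟩

/-- `AbelianVariety k` has binary products. [folklore] -/
instance hasBinaryProducts_inst : HasBinaryProducts (AbelianVariety k) :=
  hasBinaryProducts_of_hasLimit_pair _

/-- **`AbelianVariety k` has binary biproducts**: it is preadditive (`Motives/AbelianVariety`,
`instPreadditive`) with binary products (Mathlib `HasBinaryBiproducts.of_hasBinaryProducts`).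
This is the content of `End(A × B) = End A ⊕ Hom(A, B) ⊕ Hom(B, A) ⊕ End B`
(Kieffer 2024, §1.2.2 p. 22). [cite: Kieffer2024IsogenyGraphs, §1.2.2 p. 22] -/
instance hasBinaryBiproducts_inst : HasBinaryBiproducts (AbelianVariety k) :=
  HasBinaryBiproducts.of_hasBinaryProducts

/-- Every pair of abelian varieties over `k` has a biproduct in `AbelianVariety k` — the statement
of the named fact `AbelianVariety.hasBinaryBiproduct A B` of `Motives/TateAbelianFiniteSteps`
(Kieffer 2024, §1.1.1 p. 8 and §1.2.2 p. 22), now a theorem.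
[cite: Kieffer2024IsogenyGraphs, §1.1.1 p. 8 and §1.2.2 p. 22] -/
theorem hasBinaryBiproduct_inst : HasBinaryBiproduct A B := inferInstance

/-- The chosen product `A ⨯ B` of the instance is isomorphic to `A ×ₖ B`, compatibly with the
first projections. [folklore] -/
def prodIsoProd : A ⨯ B ≅ A.prod B :=
  limit.isoLimitCone ⟨_, prodBinaryFanIsLimit A B⟩

/-- `prodIsoProd` commutes with the first projections (Mathlib `limit.isoLimitCone_hom_π`).
[folklore] -/
@[reassoc (attr := simp)]
theorem prodIsoProd_hom_fst : (prodIsoProd A B).hom ≫ fst A B = Limits.prod.fst :=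
  limit.isoLimitCone_hom_π ⟨_, prodBinaryFanIsLimit A B⟩ ⟨WalkingPair.left⟩

/-- `prodIsoProd` commutes with the second projections (Mathlib `limit.isoLimitCone_hom_π`).
[folklore] -/
@[reassoc (attr := simp)]
theorem prodIsoProd_hom_snd : (prodIsoProd A B).hom ≫ snd A B = Limits.prod.snd :=
  limit.isoLimitCone_hom_π ⟨_, prodBinaryFanIsLimit A B⟩ ⟨WalkingPair.right⟩

/-- **The biproduct `A ⊞ B` is `A ×ₖ B`**: the isomorphism `A ⊞ B ≅ A ×ₖ B` whose composite
with `fst`/`snd` is `biprod.fst`/`biprod.snd` (both cones are limits of the pair `(A, B)`).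
[folklore] -/
def biprodIsoProd : A ⊞ B ≅ A.prod B :=
  (BinaryBiproduct.isLimit A B).conePointUniqueUpToIso (prodBinaryFanIsLimit A B)

/-- `biprodIsoProd` followed by `fst` is `biprod.fst` (Mathlib
`IsLimit.conePointUniqueUpToIso_hom_comp`). [folklore] -/
@[reassoc (attr := simp)]
theorem biprodIsoProd_hom_fst : (biprodIsoProd A B).hom ≫ fst A B = biprod.fst :=
  (BinaryBiproduct.isLimit A B).conePointUniqueUpToIso_hom_comp (prodBinaryFanIsLimit A B)
    ⟨WalkingPair.left⟩

/-- `biprodIsoProd` followed by `snd` is `biprod.snd` (Mathlib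
`IsLimit.conePointUniqueUpToIso_hom_comp`). [folklore] -/
@[reassoc (attr := simp)]
theorem biprodIsoProd_hom_snd : (biprodIsoProd A B).hom ≫ snd A B = biprod.snd :=
  (BinaryBiproduct.isLimit A B).conePointUniqueUpToIso_hom_comp (prodBinaryFanIsLimit A B)
    ⟨WalkingPair.right⟩

end AbelianVariety

end Literature.AlgebraicGeometry.Motives
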